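import Literature.NumberTheory.LFunctions.Polymath15BarrierCert
import Literature.NumberTheory.LFunctions.PrimeLogSeries
import HarnessLib

/-!
# Polymath 15, §8.5: the final-time half-strip from a mollified argument principle

Trunk T-ANT (`Literature/NumberTheory/LFunctions`); fourth companion of
`DeBruijnNewmanUpperBound.lean`, after `Polymath15BarrierCert.lean` (which reduced the BARRIER
hypothesis (iii) of Polymath 15, Thm. 1.2 to a discrete winding certificate for the finite sums
`f_t`, conditionally on Thm. 1.3). This file does the same for the FINAL-TIME hypothesis (ii) — in
the rectangle form "`H_{t₀}(x + iy) ≠ 0` for all `x ≥ X`, `y₀ ≤ y ≤ 1`" consumed by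
`Polymath15.final_and_barrier_of_rectangles` — following the printed argument of §8.5 (claim (b))
and §8.3 (claim (c)):

> "Fix `t`, and let `R` denote the rectangle `{x+iy : y₀ ≤ y ≤ 1; x ≥ X; N ≤ N₁}`. We wish to show
> that the holomorphic function `H_t(x+iy)/B_t(x+iy)` does not vanish in this rectangle. … To damp
> out this oscillation, we introduce an "Euler mollifier" `E_{t,5}(x+iy) := ∏_{p ≤ 5}(1 − b_p^t/p^{s_*})`
> … The left-hand side [`E_{t,5} H_t/B_t = E_{t,5} f_t + O_≤(2.05·10⁻³)`] remains holomorphic in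
> `x+iy` (even though `f_t(x+iy)` has jump discontinuities). Thus, by the argument principle, it will
> suffice to show that the left-hand side avoids the negative real axis `(-∞,0]` as `x+iy` traverses
> the boundary `∂R`."

The four edges are treated in print as follows: right edge (`N = N₁`): `f_t = 1 + O_≤(0.955)`
(§8.3); left edge (`x = X`): "`|f_t| ≥ 1` and `|arg f_t| ≤ π/2`" from the barrier computation;
upper edge (`y = 1`): `f_t = 1 + O_≤(0.8)`; lower edge (`y = y₀`): the mollified triangle
inequality Lemma 8.5 on `N`-intervals. On the first three edges `Re f_t > error`, hence
`Re(H_t/B_t) > 0`, and with `Re E > 0` the product lies in the slit plane; on the lower edge the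
closed ball of radius `max|E| · error` about `E f_t` lies in the slit plane.

## Contents (everything PROVED; no definitions, no named facts)

* `Literature.Analysis.Complex.no_zero_of_boundary_mem_slitPlane` — the argument principle in the
  form used here: `g` analytic on a neighbourhood of the closed rectangle `K` with
  `g(∂K) ⊆ ℂ ∖ (-∞,0]` has no zero on `K` (Conway V.3.4: `∮_{∂K} g'/g = 2πi·#zeros`, and the
  left side vanishes because the principal `log g` is a primitive along `∂K`,
  `integral_boundary_rect_logDeriv_eq_zero_of_mem_slitPlane`).
* (reused) `Literature.NumberTheory.LFunctions.Nicolas.mul_mem_slitPlane_of_re_pos`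
  (`PrimeLogSeries.lean`) — `Re a > 0`, `Re b > 0` ⟹ `ab ∈ ℂ ∖ (-∞,0]`.
* `Polymath15.halfStrip_zero_free_of_mollified` — **§8.5 for general parameters and a general
  mollifier.** Assume Thm. 1.3 (`effective_approximation`). Let `0 < t₀ ≤ 1/2`, `0 < y₀ < 1`,
  `200 ≤ X`, `X₁` real, and let `E` be analytic on `U = {Re z > 0, Im z > −1}` with `Re E > 0` and
  `|E| ≤ E_max` on the half-strip `x ≥ X`, `y₀ ≤ y ≤ 1`. Suppose (pointwise in `x`, `y`; `e(x,y)`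
  = the printed error majorant `errAB + errC0` at time `t₀`):
  (L) `Re f_{t₀}(X + iy) > e` for `y₀ ≤ y ≤ 1`; (T) `Re f_{t₀}(x + i) > e` for `x ≥ X`;
  (R) `Re f_{t₀}(x + iy) > e` for `x ≥ X₁`, `y₀ ≤ y ≤ 1`; (B) for `X ≤ x ≤ X₁` every `w` with
  `|w − E(x+iy₀) f_{t₀}(x+iy₀)| ≤ E_max · e(x,y₀)` lies in `ℂ ∖ (-∞,0]`. Then
  `H_{t₀}(x + iy) ≠ 0` for all `x ≥ X`, `y₀ ≤ y ≤ 1`.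
* `Polymath15.finalZeroFree_of_mollified` — the same packaged as `FinalZeroFree t₀ X y₀`.

With `E ≡ 1` (no mollifier) hypothesis (B) is implied by `|f| − e > 0` together with … — i.e. one
recovers the pointwise criterion `Polymath15.finalZeroFree_of_err_lt`; the point of §8.5 is that the
strong bound is needed only on the lower edge. The arithmetic of the lower edge (the Euler
mollifier `E_{t,D}`, the coefficients `β_n`, `α_n`, Lemma 8.5 and the uniformity over an
`N`-interval) is not formalised here; it discharges hypothesis (B) and nothing else.

## References

* D. H. J. Polymath, *Effective approximation of heat flow evolution of the Riemann `ξ` function,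
  and a new upper bound for the de Bruijn–Newman constant*, Res. Math. Sci. 6 (2019) 31
  (arXiv:1904.12438): §8.2 (claims (b), (c)), §8.3, §8.5 (the rectangle `R`, `E_{t,5}`, eq. (star),
  the four edges, Lemma 8.5).
* J. B. Conway, *Functions of One Complex Variable I*, 2nd ed., GTM 11 (1978), Ch. V, Thm. 3.4.
-/

noncomputable section

open Complex Set Filter

open scoped Real Topology

namespace Literature.Analysis.Complex

variable {a b c d : ℝ}

/-- **No zeros when the boundary values avoid the negative axis** (argument principle, Conway
V.3.4, combined with the zero change of argument in the slit plane): if `g` is analytic on a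
neighbourhood of every point of the closed rectangle `K = [a,b] × [c,d]` (`a < b`, `c < d`) and
`g(z) ∈ ℂ ∖ (-∞, 0]` for every `z ∈ ∂K`, then `g` has no zero on `K`. Proof:
`∮_{∂K} g'/g = 0` (`integral_boundary_rect_logDeriv_eq_zero_of_mem_slitPlane`) and
`∮_{∂K} g'/g = 2πi Σ_{ρ} m(ρ)` with all multiplicities `m(ρ) ≥ 1`
(`integral_boundary_rect_logDeriv`), so there is no interior zero; boundary zeros are excluded
since `0 ∉ ℂ ∖ (-∞,0]`. [cite: Conway1978, Ch. V Thm. 3.4] -/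
theorem no_zero_of_boundary_mem_slitPlane {g : ℂ → ℂ} (hab : a < b) (hcd : c < d)
    (hg : AnalyticOnNhd ℂ g (Icc a b ×ℂ Icc c d))
    (hs_bot : ∀ x ∈ Icc a b, g (x + c * I) ∈ slitPlane)
    (hs_top : ∀ x ∈ Icc a b, g (x + d * I) ∈ slitPlane)
    (hs_left : ∀ y ∈ Icc c d, g (a + y * I) ∈ slitPlane)
    (hs_right : ∀ y ∈ Icc c d, g (b + y * I) ∈ slitPlane) :
    ∀ z ∈ Icc a b ×ℂ Icc c d, g z ≠ 0 := by
  have h_bot : ∀ x ∈ Icc a b, g (x + c * I) ≠ 0 := fun x hx ↦ slitPlane_ne_zero (hs_bot x hx)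
  have h_top : ∀ x ∈ Icc a b, g (x + d * I) ≠ 0 := fun x hx ↦ slitPlane_ne_zero (hs_top x hx)
  have h_left : ∀ y ∈ Icc c d, g (a + y * I) ≠ 0 := fun y hy ↦ slitPlane_ne_zero (hs_left y hy)
  have h_right : ∀ y ∈ Icc c d, g (b + y * I) ≠ 0 :=
    fun y hy ↦ slitPlane_ne_zero (hs_right y hy)
  have hmem : ∀ x ∈ Icc a b, ∀ y ∈ Icc c d, ((x : ℂ) + y * I) ∈ Icc a b ×ℂ Icc c d :=
    fun x hx y hy ↦ ⟨by simpa using hx, by simpa using hy⟩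
  have hAP := integral_boundary_rect_logDeriv hab hcd hg h_bot h_top h_left h_right
  have h0 := integral_boundary_rect_logDeriv_eq_zero_of_mem_slitPlane (g := g) hab.le hcd.le
    (fun x hx ↦ hg _ (hmem x hx c ⟨le_rfl, hcd.le⟩))
    (fun x hx ↦ hg _ (hmem x hx d ⟨hcd.le, le_rfl⟩))
    (fun y hy ↦ hg _ (hmem a ⟨le_rfl, hab.le⟩ y hy))
    (fun y hy ↦ hg _ (hmem b ⟨hab.le, le_rfl⟩ y hy)) hs_bot hs_top hs_left hs_right
  rw [h0] at hAP
  -- the finite sum of the orders vanishes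
  have hcorner : ((a : ℂ) + c * I) ∈ Icc a b ×ℂ Icc c d := hmem a ⟨le_rfl, hab.le⟩ c ⟨le_rfl, hcd.le⟩
  have hw : g (a + c * I) ≠ 0 := h_bot a ⟨le_rfl, hab.le⟩
  have hfin := finite_zeros_reProdIm hab.le hcd.le hg hcorner hw
  rw [finsum_mem_eq_finite_toFinset_sum _ hfin] at hAP
  have hsum : ∑ ρ ∈ hfin.toFinset, ((meromorphicOrderAt g ρ).untop₀ : ℂ) = 0 := by
    have h2 : (2 * Real.pi * I : ℂ) ≠ 0 := by simp [Real.pi_ne_zero]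
    exact (mul_eq_zero.1 hAP.symm).resolve_left h2
  -- each order is a positive natural number
  have hpos : ∀ ρ ∈ hfin.toFinset, (0 : ℤ) < (meromorphicOrderAt g ρ).untop₀ := by
    intro ρ hρ
    rw [Set.Finite.mem_toFinset] at hρ
    obtain ⟨hρ0, hρK⟩ := hρ
    have hρK' : ρ ∈ Icc a b ×ℂ Icc c d := ⟨Ioo_subset_Icc_self hρK.1, Ioo_subset_Icc_self hρK.2⟩
    have han : AnalyticAt ℂ g ρ := hg ρ hρK'
    have hne := analyticOrderAt_ne_top_of_reProdIm hab.le hcd.le hg hcorner hw hρK'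
    obtain ⟨n, hn⟩ := ENat.ne_top_iff_exists.mp hne
    have hn0 : n ≠ 0 := by
      intro h
      rw [h] at hn
      have : analyticOrderAt g ρ = 0 := by exact_mod_cast hn.symm
      rw [han.analyticOrderAt_eq_zero] at this
      exact this hρ0
    rw [han.meromorphicOrderAt_eq, ← hn]
    simp only [ENat.map_coe, WithTop.untop₀_coe, Int.natCast_pos]
    omega
  -- interior points: argument principle; boundary points: the slit plane omits `0`
  intro z hz hz0
  obtain ⟨⟨hza, hzb⟩, ⟨hzc, hzd⟩⟩ := hz
  have hz_eq : z = (z.re : ℂ) + (z.im : ℂ) * I := (re_add_im z).symm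
  rcases hza.eq_or_lt with h | hza'
  · exact h_left z.im ⟨hzc, hzd⟩ (by rw [h, ← hz_eq]; exact hz0)
  rcases hzb.eq_or_lt with h | hzb'
  · exact h_right z.im ⟨hzc, hzd⟩ (by rw [← h, ← hz_eq]; exact hz0)
  rcases hzc.eq_or_lt with h | hzc'
  · exact h_bot z.re ⟨hza, hzb⟩ (by rw [h, ← hz_eq]; exact hz0)
  rcases hzd.eq_or_lt with h | hzd'
  · exact h_top z.re ⟨hza, hzb⟩ (by rw [← h, ← hz_eq]; exact hz0)
  have hzmem : z ∈ hfin.toFinset := by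
    rw [Set.Finite.mem_toFinset]; exact ⟨hz0, ⟨hza', hzb'⟩, ⟨hzc', hzd'⟩⟩
  have hsumZ : ∑ ρ ∈ hfin.toFinset, (meromorphicOrderAt g ρ).untop₀ = 0 := by
    exact_mod_cast hsum
  have := Finset.sum_pos hpos ⟨z, hzmem⟩
  rw [hsumZ] at this
  exact lt_irrefl _ this

end Literature.Analysis.Complex

namespace Literature.NumberTheory.LFunctions

namespace Polymath15

open Literature.Analysis.Complex

/-- If `|F − f| ≤ e < Re f` then `Re F > 0`. [folklore] -/
private lemma re_pos_of_norm_sub_le {F f : ℂ} {e : ℝ} (hFf : ‖F - f‖ ≤ e) (hf : e < f.re) :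
    0 < F.re := by
  have h1 : |(F - f).re| ≤ e := (abs_re_le_norm _).trans hFf
  rw [Complex.sub_re, abs_le] at h1
  linarith [h1.1]

/-- **Polymath 15, §8.5 (claim (b) with claim (c)), general parameters and general mollifier:
the final-time half-strip `x ≥ X`, `y₀ ≤ y ≤ 1` is zero-free for `H_{t₀}`.** Assume Thm. 1.3
(`effective_approximation`). Let `0 < t₀ ≤ 1/2`, `0 < y₀ < 1`, `200 ≤ X`, `X₁ ∈ ℝ`; let `E : ℂ → ℂ` be
analytic on `U = {Re z > 0, Im z > −1}` with `Re E(x+iy) > 0` and `|E(x+iy)| ≤ E_max` for `x ≥ X`,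
`y₀ ≤ y ≤ 1` (in print `E = E_{t,5}`, `|arg E| ≤ 0.553`, `|E| ≤ 1.635`). Writing `e(x,y)` for the
printed error majorant `errAB t₀ x y + errC0 t₀ x y` and `f = f_{t₀}`, assume:
(L) left edge `x = X`: `Re f(X+iy) > e` (`y₀ ≤ y ≤ 1`; in print from the barrier run);
(T) top edge `y = 1`: `Re f(x+i) > e` (`x ≥ X`; in print `f = 1 + O_≤(0.8)`);
(R) right region `x ≥ X₁`: `Re f(x+iy) > e` (`y₀ ≤ y ≤ 1`; in print claim (c), `f = 1 + O_≤(0.955)`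
for `N ≥ N₁`);
(B) bottom edge `y = y₀`, `X ≤ x ≤ X₁`: the closed ball of radius `E_max · e(x,y₀)` about
`E(x+iy₀) f(x+iy₀)` lies in `ℂ ∖ (-∞,0]` (in print eq. (star) via Lemma 8.5 on `N`-intervals).
Then `H_{t₀}(x+iy) ≠ 0` for all `x ≥ X`, `y₀ ≤ y ≤ 1`.
Proof as printed: for `x' ≥ X` put `X' = max(x', X₁) + 1`; `G = E · H_{t₀}/B_{t₀}` is analytic
near `K = [X, X'] × [y₀, 1]` (`analyticOnNhd_HoverB`); on the left, top and right edges
`|H/B − f| ≤ e < Re f` (Thm. 1.3) gives `Re(H/B) > 0`, so `G ∈ ℂ ∖ (-∞,0]`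
(`Nicolas.mul_mem_slitPlane_of_re_pos`); on the bottom edge `|G − E f| ≤ |E| e ≤ E_max e` and (B) (or (R)
when `x ≥ X₁`); hence `G ≠ 0` on `K` (`no_zero_of_boundary_mem_slitPlane`), so `H_{t₀} ≠ 0`.
[cite: Polymath2019, §8.5] -/
theorem halfStrip_zero_free_of_mollified (h : effective_approximation) {t₀ X X₁ y₀ Emax : ℝ}
    {E : ℂ → ℂ} (ht₀ : 0 < t₀) (ht₀' : t₀ ≤ 1 / 2) (hy₀ : 0 < y₀) (hy₀' : y₀ < 1) (hX : 200 ≤ X)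
    (hE : AnalyticOnNhd ℂ E certDomain)
    (hEre : ∀ x y : ℝ, X ≤ x → y₀ ≤ y → y ≤ 1 → 0 < (E (x + y * I)).re)
    (hEmax : ∀ x y : ℝ, X ≤ x → y₀ ≤ y → y ≤ 1 → ‖E (x + y * I)‖ ≤ Emax)
    (hleft : ∀ y : ℝ, y₀ ≤ y → y ≤ 1 → errAB t₀ X y + errC0 t₀ X y < (ft t₀ X y).re)
    (htop : ∀ x : ℝ, X ≤ x → errAB t₀ x 1 + errC0 t₀ x 1 < (ft t₀ x 1).re)
    (hright : ∀ x y : ℝ, X₁ ≤ x → y₀ ≤ y → y ≤ 1 →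
      errAB t₀ x y + errC0 t₀ x y < (ft t₀ x y).re)
    (hbot : ∀ x : ℝ, X ≤ x → x ≤ X₁ → ∀ w : ℂ,
      ‖w - E (x + y₀ * I) * ft t₀ x y₀‖ ≤ Emax * (errAB t₀ x y₀ + errC0 t₀ x y₀) → w ∈ slitPlane) :
    ∀ x y : ℝ, X ≤ x → y₀ ≤ y → y ≤ 1 → deBruijnH t₀ (x + y * I) ≠ 0 := by
  intro x' y' hx' hy' hy'1
  -- the mollified function
  set G : ℂ → ℂ := fun z ↦ E z * HoverB t₀ z with hG
  -- Thm. 1.3 on the half-strip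
  have happ : ∀ x y : ℝ, X ≤ x → y₀ ≤ y → y ≤ 1 →
      ‖HoverB t₀ (x + y * I) - ft t₀ x y‖ ≤ errAB t₀ x y + errC0 t₀ x y := by
    intro x y hx hy hy1
    rw [HoverB_apply]
    exact h t₀ x y ⟨ht₀, ht₀', hy₀.le.trans hy, hy1, hX.trans hx⟩
  -- where `Re f > e`, the product lies in the slit plane
  have hslit_of_re : ∀ x y : ℝ, X ≤ x → y₀ ≤ y → y ≤ 1 →
      errAB t₀ x y + errC0 t₀ x y < (ft t₀ x y).re → G (x + y * I) ∈ slitPlane := by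
    intro x y hx hy hy1 hre
    exact Nicolas.mul_mem_slitPlane_of_re_pos (hEre x y hx hy hy1)
      (re_pos_of_norm_sub_le (happ x y hx hy hy1) hre)
  -- the rectangle `K = [X, X'] × [y₀, 1]`
  set X' : ℝ := max x' X₁ + 1 with hX'
  have hXX' : X < X' := by
    have := le_max_left x' X₁; linarith
  have hX₁X' : X₁ < X' := by
    have := le_max_right x' X₁; linarith
  have hK : Icc X X' ×ℂ Icc y₀ 1 ⊆ certDomain := fun z hz ↦
    ⟨by linarith [hz.1.1], by linarith [hz.2.1]⟩
  have hGan : AnalyticOnNhd ℂ G (Icc X X' ×ℂ Icc y₀ 1) := fun z hz ↦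
    (hE z (hK hz)).mul (analyticOnNhd_HoverB t₀ z (hK hz))
  -- the four edges
  have hs_bot : ∀ x ∈ Icc X X', G (x + y₀ * I) ∈ slitPlane := by
    intro x hx
    rcases le_or_gt x X₁ with hxX₁ | hxX₁
    · refine hbot x hx.1 hxX₁ (G (x + y₀ * I)) ?_
      have hsub : G (x + y₀ * I) - E (x + y₀ * I) * ft t₀ x y₀ =
          E (x + y₀ * I) * (HoverB t₀ (x + y₀ * I) - ft t₀ x y₀) := by
        simp only [hG]; ring
      rw [hsub, norm_mul]
      exact mul_le_mul (hEmax x y₀ hx.1 le_rfl hy₀'.le) (happ x y₀ hx.1 le_rfl hy₀'.le)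
        (norm_nonneg _) ((norm_nonneg _).trans (hEmax x y₀ hx.1 le_rfl hy₀'.le))
    · exact hslit_of_re x y₀ hx.1 le_rfl hy₀'.le (hright x y₀ hxX₁.le le_rfl hy₀'.le)
  have hs_top : ∀ x ∈ Icc X X', G (x + (1 : ℝ) * I) ∈ slitPlane :=
    fun x hx ↦ hslit_of_re x 1 hx.1 hy₀'.le le_rfl (htop x hx.1)
  have hs_left : ∀ y ∈ Icc y₀ 1, G (X + y * I) ∈ slitPlane :=
    fun y hy ↦ hslit_of_re X y le_rfl hy.1 hy.2 (hleft y hy.1 hy.2)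
  have hs_right : ∀ y ∈ Icc y₀ 1, G (X' + y * I) ∈ slitPlane :=
    fun y hy ↦ hslit_of_re X' y hXX'.le hy.1 hy.2 (hright X' y hX₁X'.le hy.1 hy.2)
  have hzero := no_zero_of_boundary_mem_slitPlane (g := G) hXX' hy₀' hGan hs_bot
    (by simpa using hs_top) hs_left hs_right
  -- conclude at the point `x' + iy'`
  have hx'X' : x' ≤ X' := by
    have := le_max_left x' X₁; linarith
  have hmem : ((x' : ℂ) + y' * I) ∈ Icc X X' ×ℂ Icc y₀ 1 :=
    ⟨by simpa using And.intro hx' hx'X', by simpa using And.intro hy' hy'1⟩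
  have hG0 := hzero _ hmem
  exact deBruijnH_ne_zero_of_HoverB fun h0 ↦ hG0 (by simp only [hG, h0, mul_zero])

/-- The same packaged as hypothesis (ii) of Thm. 1.2 (`FinalZeroFree t₀ X y₀`, the curved region
`x ≥ X + √(1 − y₀²)`, `y₀ ≤ y ≤ √(1 − 2t₀)`, which lies in the half-strip).
[cite: Polymath2019, §8.2 and §8.5] -/
theorem finalZeroFree_of_mollified (h : effective_approximation) {t₀ X X₁ y₀ Emax : ℝ}
    {E : ℂ → ℂ} (ht₀ : 0 < t₀) (ht₀' : t₀ ≤ 1 / 2) (hy₀ : 0 < y₀) (hy₀' : y₀ < 1) (hX : 200 ≤ X)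
    (hE : AnalyticOnNhd ℂ E certDomain)
    (hEre : ∀ x y : ℝ, X ≤ x → y₀ ≤ y → y ≤ 1 → 0 < (E (x + y * I)).re)
    (hEmax : ∀ x y : ℝ, X ≤ x → y₀ ≤ y → y ≤ 1 → ‖E (x + y * I)‖ ≤ Emax)
    (hleft : ∀ y : ℝ, y₀ ≤ y → y ≤ 1 → errAB t₀ X y + errC0 t₀ X y < (ft t₀ X y).re)
    (htop : ∀ x : ℝ, X ≤ x → errAB t₀ x 1 + errC0 t₀ x 1 < (ft t₀ x 1).re)
    (hright : ∀ x y : ℝ, X₁ ≤ x → y₀ ≤ y → y ≤ 1 →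
      errAB t₀ x y + errC0 t₀ x y < (ft t₀ x y).re)
    (hbot : ∀ x : ℝ, X ≤ x → x ≤ X₁ → ∀ w : ℂ,
      ‖w - E (x + y₀ * I) * ft t₀ x y₀‖ ≤ Emax * (errAB t₀ x y₀ + errC0 t₀ x y₀) → w ∈ slitPlane) :
    FinalZeroFree t₀ X y₀ := by
  have hH := halfStrip_zero_free_of_mollified h ht₀ ht₀' hy₀ hy₀' hX hE hEre hEmax hleft htop
    hright hbot
  intro x y hx hy hy1
  refine hH x y (le_trans (le_add_of_nonneg_right (Real.sqrt_nonneg _)) hx) hy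
    (hy1.trans (Real.sqrt_le_one.2 (by linarith)))

end Polymath15

end Literature.NumberTheory.LFunctions

end
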